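import Literature.AnabelianGeometry.EtaleTheta.SettingModelCurve
import Mathlib.Algebra.FreeAbelianGroup.Finsupp
import HarnessLib

/-!
# A model of the [EtTh] §1 root — the class-1 (abelian) shadow: `toHat⁻¹([Δ_X,Δ_X]⁻)` meets `F₂ × 1`
# exactly in `[F₂,F₂] × 1`, i.e. `(Δ^tp_X)^ell ≅ ℤ²` in coordinates (`a`-, `b`-exponent sums)

Mochizuki, *The étale theta function …*, Publ. RIMS **45** (2009) [EtTh], §1, PRIMS PDF p. 12
"`Δ_X ↠ Δ^Θ_X ↠ Δ^ell_X := Δ^ab_X`", p. 13 "`(Δ^tp_Y)^ell` [≅ `Ẑ(1)`]" [cite: MochizukiEtTh2009, §1 p.12].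
Layer L2 of the abc-iut cell; proof-only companion (seat abc-iut-w5-d051, CLAIM 04:0xZ, first refusal of
the model owner abc-iut-L2-t1 g4 honoured) to abc-iut-L2-t1's explicit inhabitant of the root interface
(`SettingModelHeisenberg` / `…FreeGroup` / `…Galois` / `…Curve`: `Π^tp_X := F₂ × G_{ℚ_p}`,
`Δ_X = F̂₂ × 1`, `KEll := toHat⁻¹([Δ_X,Δ_X]⁻)`). abc-iut-L2-t1's part B records the CLASS-2 shadow
(`heisHom_eq_one_of_eta_mem_closure`: the closure of `[[F̂₂,F̂₂],F̂₂]` meets `F₂` inside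
`Ker(F₂ → Heis ℤ)`); this file records the CLASS-1 shadow needed to read the ell-quotient
`(Π^tp_X)^ell = Π^tp_X / KEll` of the model in coordinates:

* `xExp`/`yExp` bookkeeping: the `a`- and `b`-exponent sums `(heisHom w).x`, `(heisHom w).y` are the
  coordinates of `w` in the abelianisation `F₂^ab = FreeAbelianGroup (Fin 2) ≅ ℤ²`
  (`toFinsupp_abelianization_eq`), hence **`mem_commutator_iff_exponents`**:
  `w ∈ [F₂,F₂] ↔ (heisHom w).x = 0 ∧ (heisHom w).y = 0`;
* **`exponents_eq_zero_of_eta_mem_closure`** (class-1 shadow): if `η w ∈ [F̂₂,F̂₂]⁻` then both exponent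
  sums vanish (every `F₂ → (ℤ/M)²` extends continuously to `F̂₂` and kills `[F̂₂,F̂₂]⁻`);
* **`mem_KEll_iff_of_snd_eq_one`**: for `g ∈ Π^tp_X` with trivial Galois component,
  `g ∈ KEll ↔ Del.val g.1 ∈ [F₂,F₂]`; and `exponents_eq_zero_and_snd_eq_one_of_mem_KEll` for general `g`.

Purpose: the kernel NON-VACUITY witness of the Tate-module clause `tate2` of the origin predicate
`ThetaSetting.IsThm16Origin` (abc-iut-L2-t6; clause by abc-iut-w5-d051) at `ThetaSetting.model p`, whose
`(Δ^tp_Y)^ell / 2·(Δ^tp_Y)^ell` is read through the `b`-exponent modulo `2` (follow-up file once part E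
`SettingModel.lean` lands). HONEST LIMITS as in parts A–D: a degenerate model, consistency evidence only;
nothing of [EtTh] is asserted; no side is taken on [IUTchIII] Cor. 3.12. No definitions.
-/

noncomputable section

namespace Literature.AnabelianGeometry.EtaleTheta.SettingModel

open Literature.AnabelianGeometry.SemiGraphs
open CategoryTheory
open scoped commutatorElement

/-! ### Exponent sums are the abelianisation coordinates -/

/-- The coordinate of `w ∈ F₂` at the generator `i` in `F₂^ab = FreeAbelianGroup (Fin 2) →₀ ℤ` is its
`a`-exponent sum (`i = 0`) resp. `b`-exponent sum (`i = 1`) as computed in `Heis ℤ`.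
[cite: MochizukiEtTh2009, §1 p.12] -/
theorem toFinsupp_abelianization_eq (w : F₂) :
    FreeAbelianGroup.toFinsupp (Additive.ofMul (Abelianization.of w)) 0 = (heisHom w).x ∧
      FreeAbelianGroup.toFinsupp (Additive.ofMul (Abelianization.of w)) 1 = (heisHom w).y := by
  -- both sides are homomorphisms `F₂ → ℤ`; compare on generators
  let L : Fin 2 → (F₂ →* Multiplicative ℤ) := fun i =>
    (AddMonoidHom.toMultiplicativeRight
      ((Finsupp.applyAddHom i).comp FreeAbelianGroup.toFinsupp)).comp Abelianization.of
  have hL : ∀ i w, L i w =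
      Multiplicative.ofAdd (FreeAbelianGroup.toFinsupp (Additive.ofMul (Abelianization.of w)) i) :=
    fun i w => rfl
  have hLof : ∀ i j : Fin 2, L i (FreeGroup.of j) = Multiplicative.ofAdd (if j = i then 1 else 0) := by
    intro i j
    rw [hL]
    change Multiplicative.ofAdd (FreeAbelianGroup.toFinsupp (FreeAbelianGroup.of j) i) = _
    rw [FreeAbelianGroup.toFinsupp_of, Finsupp.single_apply]
  have h0 : L 0 = Heis.xHom.comp heisHom := by
    refine FreeGroup.ext_hom _ _ fun j => ?_
    rw [hLof]
    fin_cases j <;> simp [Heis.xHom]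
  have h1 : L 1 = Heis.yHom.comp heisHom := by
    refine FreeGroup.ext_hom _ _ fun j => ?_
    rw [hLof]
    fin_cases j <;> simp [Heis.yHom]
  constructor
  · have := congrArg (fun f : F₂ →* Multiplicative ℤ => Multiplicative.toAdd (f w)) h0
    simpa [hL, Heis.xHom] using this
  · have := congrArg (fun f : F₂ →* Multiplicative ℤ => Multiplicative.toAdd (f w)) h1
    simpa [hL, Heis.yHom] using this

/-- **`[F₂,F₂]` = the words with both exponent sums zero** (`F₂^ab ≅ ℤ²`).
[cite: MochizukiEtTh2009, §1 p.12] -/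
theorem mem_commutator_iff_exponents (w : F₂) :
    w ∈ commutator F₂ ↔ (heisHom w).x = 0 ∧ (heisHom w).y = 0 := by
  obtain ⟨hx, hy⟩ := toFinsupp_abelianization_eq w
  rw [← Abelianization.ker_of, MonoidHom.mem_ker]
  have h00 : FreeAbelianGroup.toFinsupp (X := Fin 2) 0 = 0 := map_zero _
  constructor
  · intro h
    have e : Additive.ofMul (Abelianization.of w) = 0 := by rw [h]; rfl
    rw [e] at hx hy
    have z0 : (FreeAbelianGroup.toFinsupp (X := Fin 2) 0) 0 = 0 :=
      (DFunLike.congr_fun h00 0).trans (Finsupp.zero_apply)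
    have z1 : (FreeAbelianGroup.toFinsupp (X := Fin 2) 0) 1 = 0 :=
      (DFunLike.congr_fun h00 1).trans (Finsupp.zero_apply)
    exact ⟨hx.symm.trans z0, hy.symm.trans z1⟩
  · rintro ⟨h0, h1⟩
    have hz : FreeAbelianGroup.toFinsupp (Additive.ofMul (Abelianization.of w)) = 0 := by
      ext i
      fin_cases i
      · simpa [h0] using hx
      · simpa [h1] using hy
    have : Additive.ofMul (Abelianization.of w) = 0 := by
      have hinj : Function.Injective (FreeAbelianGroup.toFinsupp (X := Fin 2)) :=
        (FreeAbelianGroup.equivFinsupp (Fin 2)).injective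
      exact hinj (hz.trans h00.symm)
    exact this

/-! ### The class-1 shadow: `[F̂₂,F̂₂]⁻ ∩ F₂ ⊆ {exponent sums zero}` -/

/-- **If `η w` lies in the closure of `[F̂₂, F̂₂]`, both exponent sums of `w` vanish.** Every
`F₂ → (ℤ/M) × (ℤ/M)`, `w ↦ (x(w), y(w)) mod M`, extends continuously to `F̂₂`, kills commutators (abelian
target) and hence — its kernel being closed — their closure; so `x(w) ≡ y(w) ≡ 0` modulo every `M`.
(The model's form of "the kernel of `Δ^tp_X ↠ (Δ^tp_X)^ell` is induced by `Δ_X ↠ Δ^ab_X`", p. 12.)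
[cite: MochizukiEtTh2009, §1 p.12] -/
theorem exponents_eq_zero_of_eta_mem_closure (w : F₂)
    (hw : eta w ∈ (⁅(⊤ : Subgroup F₂hat), (⊤ : Subgroup F₂hat)⁆).topologicalClosure) :
    (heisHom w).x = 0 ∧ (heisHom w).y = 0 := by
  -- divisibility by every `M ≥ 1`
  have key : ∀ M : ℕ, 0 < M → (M : ℤ) ∣ (heisHom w).x ∧ (M : ℤ) ∣ (heisHom w).y := by
    intro M hM
    haveI : NeZero M := ⟨hM.ne'⟩
    let Q : Type := Multiplicative (ZMod M) × Multiplicative (ZMod M)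
    letI : TopologicalSpace Q := ⊥
    haveI : DiscreteTopology Q := ⟨rfl⟩
    let red : Multiplicative ℤ →* Multiplicative (ZMod M) := (Int.castAddHom (ZMod M)).toMultiplicative
    let f : F₂ →* Q := (red.comp (Heis.xHom.comp heisHom)).prod (red.comp (Heis.yHom.comp heisHom))
    obtain ⟨F, hF⟩ := exists_continuousMonoidHom_extend F₂ Q f
    have hker : (⁅(⊤ : Subgroup F₂hat), (⊤ : Subgroup F₂hat)⁆).topologicalClosure ≤ F.toMonoidHom.ker := by
      refine Subgroup.topologicalClosure_minimal _ ?_ ?_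
      · rw [← commutator_def]
        exact Abelianization.commutator_subset_ker F.toMonoidHom
      · have : ((F.toMonoidHom.ker : Subgroup F₂hat) : Set F₂hat) = F ⁻¹' {1} := by
          ext x; simp [MonoidHom.mem_ker]
        rw [this]
        exact (isClosed_discrete _).preimage F.continuous
    have h1 : F (eta w) = 1 := hker hw
    rw [eta_apply, hF] at h1
    have hx : red (Heis.xHom (heisHom w)) = 1 := congrArg Prod.fst h1
    have hy : red (Heis.yHom (heisHom w)) = 1 := congrArg Prod.snd h1
    change Multiplicative.ofAdd (((heisHom w).x : ℤ) : ZMod M) = 1 at hx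
    change Multiplicative.ofAdd (((heisHom w).y : ℤ) : ZMod M) = 1 at hy
    rw [ofAdd_eq_one, ZMod.intCast_zmod_eq_zero_iff_dvd] at hx hy
    exact ⟨hx, hy⟩
  have zero_of : ∀ n : ℤ, (∀ M : ℕ, 0 < M → (M : ℤ) ∣ n) → n = 0 := by
    intro n hn
    have h := hn (n.natAbs + 1) (Nat.succ_pos _)
    exact Int.eq_zero_of_dvd_of_natAbs_lt_natAbs h (by rw [Int.natAbs_natCast]; omega)
  exact ⟨zero_of _ fun M hM => (key M hM).1, zero_of _ fun M hM => (key M hM).2⟩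

variable (p : ℕ) [Fact p.Prime]

/-- A continuous homomorphism maps the closure of a subgroup into the closure of its image (private
copy of abc-iut-L2-t1's helper). [folklore] -/
private theorem map_mem_topologicalClosure_map' {G G' : Type*} [Group G] [TopologicalSpace G]
    [IsTopologicalGroup G] [Group G'] [TopologicalSpace G'] [IsTopologicalGroup G'] (f : G →* G')
    (hf : Continuous f) {H : Subgroup G} {x : G} (hx : x ∈ H.topologicalClosure) :
    f x ∈ (H.map f).topologicalClosure := by
  have hx' : x ∈ closure (H : Set G) := by
    have : x ∈ (H.topologicalClosure : Set G) := hx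
    rwa [Subgroup.topologicalClosure_coe] at this
  have h2 := image_closure_subset_closure_image hf ⟨x, hx', rfl⟩
  show f x ∈ ((H.map f).topologicalClosure : Set G')
  rw [Subgroup.topologicalClosure_coe, Subgroup.coe_map]
  exact h2

/-- **`KEll ⊆ {exponent sums zero} × 1`**: an element of `Π^tp_X` whose image lies in `[Δ_X,Δ_X]⁻` has
trivial Galois component and vanishing `a`- and `b`-exponent sums (the class-1 shadow projected to `F̂₂`).
[cite: MochizukiEtTh2009, §1 p.12] -/
theorem exponents_eq_zero_and_snd_eq_one_of_mem_KEll {g : PiTp p} (hg : g ∈ KEll p) :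
    (heisHom (Del.val g.1)).x = 0 ∧ (heisHom (Del.val g.1)).y = 0 ∧ g.2 = 1 := by
  have hmem : (curve p).toHat g ∈ (⁅(curve p).DeltaHat, (curve p).DeltaHat⁆).topologicalClosure := hg
  have hle : (⁅(curve p).DeltaHat, (curve p).DeltaHat⁆ : Subgroup (PiHt p)) ≤
      ⁅(⊤ : Subgroup (PiHt p)), (⊤ : Subgroup (PiHt p))⁆ := Subgroup.commutator_mono le_top le_top
  have h1 := Subgroup.topologicalClosure_mono hle hmem
  have h2 := map_mem_topologicalClosure_map' (MonoidHom.fst F₂hatT (GamHatT p)) continuous_fst h1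
  have hsurj : Function.Surjective (MonoidHom.fst F₂hatT (GamHatT p)) := fun x => ⟨(x, 1), rfl⟩
  rw [Subgroup.map_commutator, Subgroup.map_top_of_surjective _ hsurj] at h2
  have hfst : (MonoidHom.fst F₂hatT (GamHatT p)) ((curve p).toHat g) = eta (Del.val g.1) := rfl
  rw [hfst] at h2
  obtain ⟨hx, hy⟩ := exponents_eq_zero_of_eta_mem_closure (Del.val g.1) h2
  refine ⟨hx, hy, ?_⟩
  have h3 := snd_eq_one_of_mem_deltaHat p (toHat_mem_deltaHat_of_mem_KEll p hg)
  exact etaGam_injective p (by rw [map_one]; exact h3)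

/-- `[F₂,F₂] × 1 ⊆ KEll`: for `g` with trivial Galois component and `Del.val g.1 ∈ [F₂,F₂]`,
`toHat g = (η(g.1), 1)` is a product of commutators of elements of `Δ_X = F̂₂ × 1`.
[cite: MochizukiEtTh2009, §1 p.12] -/
theorem mem_KEll_of_mem_commutator {g : PiTp p} (h2 : g.2 = 1)
    (h1 : Del.val g.1 ∈ commutator F₂) : g ∈ KEll p := by
  -- the embedding `u ↦ (η u, 1)` of `F₂` into `Π_X`
  let ι : F₂ →* PiHt p := (MonoidHom.inl F₂hatT (GamHatT p)).comp eta
  have hι : ∀ u, ι u = (eta u, 1) := fun u => rfl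
  have hrange : ι.range ≤ (curve p).DeltaHat := by
    rintro _ ⟨u, rfl⟩
    rw [hι]
    exact mk_one_mem_deltaHat p (eta u)
  have hg : (curve p).toHat g = ι (Del.val g.1) := by
    change toHatM p g = _
    rw [toHatM_apply, hι, h2, map_one]
  change (curve p).toHat.toMonoidHom g ∈ (⁅(curve p).DeltaHat, (curve p).DeltaHat⁆).topologicalClosure
  refine Subgroup.le_topologicalClosure _ ?_
  change (curve p).toHat g ∈ _
  rw [hg]
  have hmap : (commutator F₂).map ι ≤ ⁅(curve p).DeltaHat, (curve p).DeltaHat⁆ := by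
    rw [commutator_def, Subgroup.map_commutator, ← MonoidHom.range_eq_map]
    exact Subgroup.commutator_mono hrange hrange
  exact hmap ⟨Del.val g.1, h1, rfl⟩

/-- **The class-1 shadow, exact form on `Δ^tp_X = F₂ × 1`**: for `g ∈ Π^tp_X` with trivial Galois
component, `g ∈ KEll ↔` both exponent sums of `g.1` vanish `↔ Del.val g.1 ∈ [F₂,F₂]` — i.e.
`(Δ^tp_X)^ell ≅ ℤ²` via `(x, y)`. [cite: MochizukiEtTh2009, §1 p.12] -/
theorem mem_KEll_iff_of_snd_eq_one {g : PiTp p} (h2 : g.2 = 1) :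
    g ∈ KEll p ↔ (heisHom (Del.val g.1)).x = 0 ∧ (heisHom (Del.val g.1)).y = 0 := by
  constructor
  · intro hg
    obtain ⟨hx, hy, -⟩ := exponents_eq_zero_and_snd_eq_one_of_mem_KEll p hg
    exact ⟨hx, hy⟩
  · intro h
    exact mem_KEll_of_mem_commutator p h2 ((mem_commutator_iff_exponents _).mpr h)

end Literature.AnabelianGeometry.EtaleTheta.SettingModel

end
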